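import Literature.Probability.Process.BrownianVec
import HarnessLib

/-!
# Uniform partitions of a time interval: pathwise lemmas

Deterministic bookkeeping for conditional-increment ("Riemann-sum") proofs of martingale
properties over the uniform partition of `[s, t] ⊆ ℝ≥0` into `n` cells given by the tree's grid
`IsBrownianVec.grid s t n k = s + k · (t − s)/n` (`BrownianVec`), with mesh
`mesh s t n = (t − s)/n`:

* `coe_mesh`, `tendsto_mesh`, `mesh_pos`, `natCast_mul_coe_mesh`, `grid_succ'`, `grid_monotone`;
* `eventually_forall_abs_sub_le` — **a continuous path oscillates by `≤ ε` on every cell,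
  eventually in `n`** (uniform continuity on the compact interval);
* `card_filter_lt_and_lt_sub_le` — **counting the cells of large increment**: for a monotone
  `I` with `I(T) − I(s) ≤ K`, at most `K/θ + 1` cells `[tᵢ, tᵢ₊₁]` with `tᵢ < T` have
  `I(tᵢ₊₁) − I(tᵢ) > θ` (the cells ending before `T` share the total increment `K`, and at most
  one cell straddles `T`);
* `abs_sub_mul_integral_le` — **the cell identity for `∫ J` with `Z J = 𝟙{Z ≠ 0}`**:
  `|(b − a) − Z(a) ∫_a^b J| ≤ (sup_{[a,b]} |Z − Z(a)|) ∫_a^b J + Leb{r ∈ (a, b] : Z(r) = 0}`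
  (from `1 − Z(a)J = (Z − Z(a))J + 𝟙{Z = 0}` pointwise).

No probability; no named facts; no new grid (the existing `IsBrownianVec.grid` is reused).
-/

noncomputable section

open MeasureTheory Filter Set
open scoped NNReal Topology

namespace Literature.Probability.Process

open IsBrownianVec (grid grid_zero grid_succ grid_self le_grid grid_le coe_grid)

/-! ### The mesh of the uniform grid -/

/-- The mesh `(t − s)/n` of the uniform partition `IsBrownianVec.grid s t n` of `[s, t]`. [folklore] -/
def mesh (s t : ℝ≥0) (n : ℕ) : ℝ≥0 := (t - s) / n

variable {s t : ℝ≥0} {n : ℕ}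

/-- `tₖ₊₁ = tₖ + mesh`. [folklore] -/
theorem grid_succ' (s t : ℝ≥0) (n k : ℕ) : grid s t n (k + 1) = grid s t n k + mesh s t n :=
  grid_succ s t n k

/-- The grid is monotone in the index. [folklore] -/
theorem grid_monotone (s t : ℝ≥0) (n : ℕ) : Monotone (grid s t n) := fun i j hij ↦ by
  simp only [grid, nsmul_eq_mul]; gcongr

/-- The mesh as a real number. [folklore] -/
theorem coe_mesh (hst : s ≤ t) (n : ℕ) : (mesh s t n : ℝ) = ((t : ℝ) - s) / n := by
  simp only [mesh]; push_cast [NNReal.coe_sub hst]; ring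

/-- The mesh tends to `0`. [folklore] -/
theorem tendsto_mesh (hst : s ≤ t) : Tendsto (fun n ↦ (mesh s t n : ℝ)) atTop (𝓝 0) := by
  simp_rw [coe_mesh hst]
  exact tendsto_const_nhds.div_atTop tendsto_natCast_atTop_atTop

/-- The mesh is positive for `s < t` and `n ≠ 0`. [folklore] -/
theorem mesh_pos (hst : s < t) (hn : n ≠ 0) : 0 < mesh s t n := by
  rw [mesh]; exact div_pos (tsub_pos_of_lt hst) (by positivity)

/-- `n · mesh = t − s` (as real numbers, `n ≠ 0`). [folklore] -/
theorem natCast_mul_coe_mesh (hst : s ≤ t) (hn : n ≠ 0) : (n : ℝ) * (mesh s t n : ℝ) = (t : ℝ) - s := by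
  rw [coe_mesh hst, mul_div_cancel₀ _ (Nat.cast_ne_zero.2 hn)]

/-! ### Continuous paths oscillate little on every cell, eventually -/

/-- **Uniform smallness of the oscillation over the cells**: for a continuous `f` and `ε > 0`,
eventually in `n`, `|f(r) − f(tₖ)| ≤ ε` for every cell `k < n` and every `r ∈ [tₖ, tₖ₊₁]`.
[folklore] -/
theorem eventually_forall_abs_sub_le {f : ℝ≥0 → ℝ} (hf : Continuous f) (hst : s ≤ t) {ε : ℝ} (hε : 0 < ε) :
    ∀ᶠ n : ℕ in atTop, ∀ k < n, ∀ r : ℝ≥0, grid s t n k ≤ r → r ≤ grid s t n (k + 1) →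
      |f r - f (grid s t n k)| ≤ ε := by
  have huc : UniformContinuousOn f (Icc s t) := isCompact_Icc.uniformContinuousOn_of_continuous hf.continuousOn
  obtain ⟨δ, hδ, hδf⟩ := Metric.uniformContinuousOn_iff.1 huc ε hε
  filter_upwards [(tendsto_mesh hst).eventually (gt_mem_nhds hδ)] with n hn k hk r hr1 hr2
  have hkI : grid s t n k ∈ Icc s t := ⟨le_grid s t n k, grid_le hst hk.le⟩
  have hk1 : grid s t n (k + 1) ≤ t := grid_le hst (by omega)
  have hrI : r ∈ Icc s t := ⟨(le_grid s t n k).trans hr1, hr2.trans hk1⟩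
  have hdist : dist r (grid s t n k) < δ := by
    have hr1' : ((grid s t n k : ℝ≥0) : ℝ) ≤ r := by exact_mod_cast hr1
    rw [NNReal.dist_eq, abs_of_nonneg (sub_nonneg.2 hr1')]
    have h2 : (r : ℝ) ≤ grid s t n k + mesh s t n := by
      have := hr2; rw [grid_succ'] at this; exact_mod_cast this
    linarith
  exact le_of_lt (hδf r hrI (grid s t n k) hkI hdist)

/-! ### Counting the cells of large increment -/

/-- The cells ending before `T` form an initial segment. [folklore] -/
theorem exists_initial_segment (s t T : ℝ≥0) (n : ℕ) :
    ∃ m ≤ n, ∀ k < n, (grid s t n (k + 1) ≤ T ↔ k < m) := by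
  classical
  by_cases hall : ∀ k < n, grid s t n (k + 1) ≤ T
  · exact ⟨n, le_rfl, fun k hk ↦ ⟨fun _ ↦ hk, fun _ ↦ hall k hk⟩⟩
  push Not at hall
  -- the first cell ending after `T`
  let m := Nat.find (⟨_, hall.choose_spec⟩ : ∃ k, k < n ∧ T < grid s t n (k + 1))
  have hm : m < n ∧ T < grid s t n (m + 1) := Nat.find_spec (⟨_, hall.choose_spec⟩ : ∃ k, k < n ∧ T < grid s t n (k + 1))
  have hmin : ∀ k < m, ¬(k < n ∧ T < grid s t n (k + 1)) := fun k hk ↦ Nat.find_min _ hk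
  refine ⟨m, hm.1.le, fun k hk ↦ ⟨fun h ↦ ?_, fun h ↦ ?_⟩⟩
  · by_contra hge
    push Not at hge
    have := grid_monotone s t n (Nat.succ_le_succ hge)
    exact absurd (hm.2.trans_le (this.trans h)) (lt_irrefl _)
  · have := hmin k h
    push Not at this
    exact this hk

/-- **At most `K/θ + 1` cells `[tₖ, tₖ₊₁]` with `tₖ < T` carry an increment `> θ`** of a monotone
`I` with `I(T) − I(s) ≤ K` (`θ > 0`, `s ≤ T`). [folklore] -/
theorem card_filter_lt_and_lt_sub_le {I : ℝ≥0 → ℝ} (hI : Monotone I) {T : ℝ≥0} (hsT : s ≤ T)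
    {K θ : ℝ} (hθ : 0 < θ) (hK : I T - I s ≤ K) (n : ℕ) :
    (((Finset.range n).filter fun k ↦ grid s t n k < T ∧ θ < I (grid s t n (k + 1)) - I (grid s t n k)).card : ℝ) ≤
      K / θ + 1 := by
  classical
  obtain ⟨m, hmn, hm⟩ := exists_initial_segment s t T n
  set P : ℕ → Prop := fun k ↦ grid s t n k < T ∧ θ < I (grid s t n (k + 1)) - I (grid s t n k) with hP
  -- split according to whether the cell ends before `T`
  have hsplit : (Finset.range n).filter P ⊆
      ((Finset.range m).filter fun k ↦ θ < I (grid s t n (k + 1)) - I (grid s t n k)) ∪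
        ((Finset.range n).filter fun k ↦ grid s t n k < T ∧ T < grid s t n (k + 1)) := by
    intro k hk
    rw [Finset.mem_filter, Finset.mem_range] at hk
    obtain ⟨hkn, hk1, hk2⟩ := hk
    rw [Finset.mem_union, Finset.mem_filter, Finset.mem_filter, Finset.mem_range, Finset.mem_range]
    by_cases hend : grid s t n (k + 1) ≤ T
    · exact Or.inl ⟨(hm k hkn).1 hend, hk2⟩
    · exact Or.inr ⟨hkn, hk1, not_le.1 hend⟩
  -- the straddling cells: at most one
  have hone : ((Finset.range n).filter fun k ↦ grid s t n k < T ∧ T < grid s t n (k + 1)).card ≤ 1 := by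
    refine Finset.card_le_one.2 fun i hi j hj ↦ ?_
    rw [Finset.mem_filter] at hi hj
    by_contra hij
    rcases lt_or_gt_of_ne hij with h | h
    · have := grid_monotone s t n (Nat.succ_le_of_lt h)
      exact absurd (hi.2.2.trans_le (this.trans hj.2.1.le)) (lt_irrefl _)
    · have := grid_monotone s t n (Nat.succ_le_of_lt h)
      exact absurd (hj.2.2.trans_le (this.trans hi.2.1.le)) (lt_irrefl _)
  -- the cells ending before `T`: `θ · card ≤ Σ increments ≤ I(t_m) − I(s) ≤ K`
  set F := (Finset.range m).filter fun k ↦ θ < I (grid s t n (k + 1)) - I (grid s t n k) with hF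
  have hincr : ∀ k, 0 ≤ I (grid s t n (k + 1)) - I (grid s t n k) := fun k ↦
    sub_nonneg.2 (hI (grid_monotone s t n (Nat.le_succ k)))
  have htele : ∑ k ∈ Finset.range m, (I (grid s t n (k + 1)) - I (grid s t n k)) = I (grid s t n m) - I s := by
    rw [Finset.sum_range_sub (fun k ↦ I (grid s t n k)), grid_zero]
  have hgm : I (grid s t n m) - I s ≤ K := by
    refine le_trans (sub_le_sub_right (hI ?_) _) hK
    rcases m.eq_zero_or_pos with h0 | hpos
    · subst h0; rw [grid_zero]; exact hsT
    · obtain ⟨k, rfl⟩ := Nat.exists_eq_succ_of_ne_zero hpos.ne'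
      exact (hm k (by omega)).2 (Nat.lt_succ_self k)
  have hFcard : θ * (F.card : ℝ) ≤ K := by
    calc θ * (F.card : ℝ) = ∑ k ∈ F, θ := by rw [Finset.sum_const, nsmul_eq_mul, mul_comm]
      _ ≤ ∑ k ∈ F, (I (grid s t n (k + 1)) - I (grid s t n k)) :=
          Finset.sum_le_sum fun k hk ↦ (Finset.mem_filter.1 hk).2.le
      _ ≤ ∑ k ∈ Finset.range m, (I (grid s t n (k + 1)) - I (grid s t n k)) :=
          Finset.sum_le_sum_of_subset_of_nonneg (Finset.filter_subset _ _) fun k _ _ ↦ hincr k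
      _ ≤ K := by rw [htele]; exact hgm
  have hFle : (F.card : ℝ) ≤ K / θ := by rw [le_div_iff₀ hθ, mul_comm]; exact hFcard
  calc (((Finset.range n).filter P).card : ℝ)
      ≤ ((F ∪ ((Finset.range n).filter fun k ↦ grid s t n k < T ∧ T < grid s t n (k + 1))).card : ℝ) := by
        exact_mod_cast Finset.card_le_card hsplit
    _ ≤ (F.card : ℝ) + (((Finset.range n).filter fun k ↦ grid s t n k < T ∧ T < grid s t n (k + 1)).card : ℝ) := by
        exact_mod_cast Finset.card_union_le _ _
    _ ≤ K / θ + 1 := add_le_add hFle (by exact_mod_cast hone)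

/-! ### The cell identity for `∫ J` when `Z J = 𝟙{Z ≠ 0}` -/

/-- **`|(b − a) − Z(a) ∫_a^b J| ≤ M ∫_a^b J + Leb{r ∈ (a, b] : Z(r) = 0}`** whenever `J ≥ 0` is
integrable on `[a, b]`, `Z · J = 𝟙{Z ≠ 0}` on `[a, b]`, `{Z = 0}` is measurable and
`|Z(r) − Z(a)| ≤ M` on `[a, b]`: indeed `1 − Z(a)J = (Z − Z(a))J + 𝟙{Z = 0}` pointwise. This is how
the drift `φ ΔI + h H = H (h − Z ΔI)` of one cell of the conditional-increment proof of [LSW]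
Lemma 8.9 is controlled by the oscillation of `Z` and the Lebesgue-null zero set of the Bessel
process. [folklore] -/
theorem abs_sub_mul_integral_le {Z J : ℝ → ℝ} {a b M : ℝ} (hab : a ≤ b) (hJ : IntervalIntegrable J volume a b)
    (hJ0 : ∀ r, 0 ≤ J r) (hZJ : ∀ r ∈ Icc a b, Z r * J r = if Z r = 0 then 0 else 1) (hZ : MeasurableSet {r | Z r = 0})
    (hM : ∀ r ∈ Icc a b, |Z r - Z a| ≤ M) :
    |(b - a) - Z a * ∫ r in a..b, J r| ≤ M * (∫ r in a..b, J r) + volume.real ({r | Z r = 0} ∩ Ioc a b) := by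
  have hM0 : 0 ≤ M := (abs_nonneg _).trans (hM a (left_mem_Icc.2 hab))
  have hIoc : uIoc a b ⊆ Icc a b := by rw [uIoc_of_le hab]; exact Ioc_subset_Icc_self
  -- the pointwise identity on the cell
  have hpt : ∀ r ∈ Icc a b, 1 - Z a * J r = (Z r - Z a) * J r + {r | Z r = 0}.indicator (fun _ ↦ (1 : ℝ)) r := by
    intro r hr
    have h := hZJ r hr
    by_cases hz : Z r = 0
    · rw [Set.indicator_of_mem (show r ∈ {r | Z r = 0} from hz)]
      rw [if_pos hz] at h
      have : Z r * J r = 0 := h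
      nlinarith [this]
    · rw [Set.indicator_of_notMem (show r ∉ {r | Z r = 0} from hz), if_neg hz] at *
      linarith
  -- integrability of the pieces
  have hind : IntervalIntegrable ({r | Z r = 0}.indicator fun _ ↦ (1 : ℝ)) volume a b := by
    refine (intervalIntegrable_const (c := (1 : ℝ))).mono_fun' ((measurable_const.indicator hZ).aestronglyMeasurable) ?_
    exact ae_of_all _ fun r ↦ by
      show ‖{r | Z r = 0}.indicator (fun _ ↦ (1 : ℝ)) r‖ ≤ 1
      rw [Real.norm_eq_abs]; by_cases hr : r ∈ {r | Z r = 0} <;> simp [hr]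
  have hZaJ : IntervalIntegrable (fun r ↦ Z a * J r) volume a b := hJ.const_mul _
  have hdiff : IntervalIntegrable (fun r ↦ (Z r - Z a) * J r) volume a b := by
    have h1 : IntervalIntegrable (fun r ↦ 1 - Z a * J r) volume a b := intervalIntegrable_const.sub hZaJ
    have := h1.sub hind
    refine this.congr fun r hr ↦ ?_
    show 1 - Z a * J r - {r | Z r = 0}.indicator (fun _ ↦ (1 : ℝ)) r = (Z r - Z a) * J r
    rw [hpt r (hIoc hr)]; ring
  -- integrate the identity
  have hlhs : (b - a) - Z a * ∫ r in a..b, J r = ∫ r in a..b, (1 - Z a * J r) := by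
    rw [intervalIntegral.integral_sub intervalIntegrable_const hZaJ, intervalIntegral.integral_const,
      intervalIntegral.integral_const_mul, smul_eq_mul, mul_one]
  have hsplit : ∫ r in a..b, (1 - Z a * J r) = (∫ r in a..b, (Z r - Z a) * J r) +
      ∫ r in a..b, {r | Z r = 0}.indicator (fun _ ↦ (1 : ℝ)) r := by
    rw [← intervalIntegral.integral_add hdiff hind]
    exact intervalIntegral.integral_congr fun r hr ↦ hpt r (by rwa [uIcc_of_le hab] at hr)
  have hvol : ∫ r in a..b, {r | Z r = 0}.indicator (fun _ ↦ (1 : ℝ)) r = volume.real ({r | Z r = 0} ∩ Ioc a b) := by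
    rw [intervalIntegral.integral_of_le hab, integral_indicator hZ, Measure.restrict_restrict hZ,
      setIntegral_const, smul_eq_mul, mul_one]
  have hbound : |∫ r in a..b, (Z r - Z a) * J r| ≤ M * ∫ r in a..b, J r := by
    rw [← intervalIntegral.integral_const_mul]
    calc |∫ r in a..b, (Z r - Z a) * J r| ≤ ∫ r in a..b, |(Z r - Z a) * J r| :=
          intervalIntegral.abs_integral_le_integral_abs hab
      _ ≤ ∫ r in a..b, M * J r := by
          refine intervalIntegral.integral_mono_on hab hdiff.abs (hJ.const_mul M) fun r hr ↦ ?_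
          rw [abs_mul, abs_of_nonneg (hJ0 r)]
          exact mul_le_mul_of_nonneg_right (hM r hr) (hJ0 r)
  have hvol0 : 0 ≤ volume.real ({r | Z r = 0} ∩ Ioc a b) := measureReal_nonneg
  rw [hlhs, hsplit, hvol]
  calc |(∫ r in a..b, (Z r - Z a) * J r) + volume.real ({r | Z r = 0} ∩ Ioc a b)|
      ≤ |∫ r in a..b, (Z r - Z a) * J r| + |volume.real ({r | Z r = 0} ∩ Ioc a b)| := abs_add_le _ _
    _ ≤ M * (∫ r in a..b, J r) + volume.real ({r | Z r = 0} ∩ Ioc a b) := by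
        rw [abs_of_nonneg hvol0]; exact add_le_add hbound le_rfl

end Literature.Probability.Process

end
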